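import Summits.HubbardSuperconductivity.HubbardSuperconductivity.Theorems.AnisotropyChordTransferFibre3RowDLoopTables
import Summits.HubbardSuperconductivity.HubbardSuperconductivity.Theorems.AnisotropyChordTransferFibre3LatticeEnergy

/-!
# Route `AnisotropyChord` / H0 rotor rung, row D (KT-2a) Stage 1.5: the GRADIENT-WEIGHT constant `c_W` and the N-table with a GENERIC zone constant

Stage 1 of the row-D (KT-2a″, `∀ L ≥ 128`) loop majorants (`…RowDLoopKit` … `…RowDCellCheck`) bounds every gradient-weighted
slot by the ZONE LEMMA `(w_e(q)·g(q))² ≤ c_Z(ν)·g(q)`, `c_Z = π²/(4 − π²ν) ≈ 2.5–2.7`.  The weight itself satisfies the sharper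
★ `wnorm_sq_le_two_epsT`: `w_e(q)² = 2(1 − cos θ(q·e)) ≤ 2ε(q)`, whence ★ `wg_sq_leW`: `(w_e g)² ≤ c_W·g` with
★ `cW = 2ε₁/(2ε₁ − λ₂) ≈ 1.0–1.03` (`2ε(q)g(q) = 1 + λ₂/(2ε(q) − λ₂) ≤ 1 + λ₂/(2ε₁ − λ₂)` off the origin) — a factor ≈ 2.5 on every
`c_Z` in the N-type tables.  To make the improvement (and any later one) a drop-in, this file re-proves the generic sum families
and ★ `norm_loop3w_leC` — the N-type three-slot product bound of `…RowDLoopTables` — for an ARBITRARY constant `c ≥ 0` satisfying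
the slot hypothesis `∀ q e, (w_e(q) g(q))² ≤ c·g(q)` (table ★ `bnd3AtC c` = `bnd3 … c`); `c = c_W` is discharged by `wg_sq_leW`.
Prover seat `hubbard-h0-rotor-p1` g31 (route lead); helper for piece A = stmt-HubbardSuperconductivity-23918 of rung 19089
(`--supports`, helper class).  Nothing here proves superconductivity in the Hubbard model; lemmas for ONE row of ONE conditional
reduction.  Tree imports only; no sorry.
-/

set_option linter.dupNamespace false
set_option autoImplicit false

open scoped BigOperators

namespace Summit.HubbardSuperconductivity.HubbardSuperconductivity.Theorems.AnisotropyChord.Transfer.Fibre3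

namespace RowD

open RowC L2.N1

/-! ## §1 The gradient-weight constant `c_W` -/

/-- `‖1 − e^{−ix}‖² = 2(1 − cos x)`. [folklore] -/
theorem norm_one_sub_exp_neg_sq (x : ℝ) :
    ‖(1 : ℂ) - Complex.exp (-(Complex.I * (x : ℂ)))‖ ^ 2 = 2 * (1 - Real.cos x) := by
  have hre : ((1 : ℂ) - Complex.exp (-(Complex.I * (x : ℂ)))).re = 1 - Real.cos x := by
    rw [show -(Complex.I * (x : ℂ)) = ((-x : ℝ) : ℂ) * Complex.I by push_cast; ring, Complex.sub_re, Complex.one_re,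
      Complex.exp_ofReal_mul_I_re, Real.cos_neg]
  have him : ((1 : ℂ) - Complex.exp (-(Complex.I * (x : ℂ)))).im = Real.sin x := by
    rw [show -(Complex.I * (x : ℂ)) = ((-x : ℝ) : ℂ) * Complex.I by push_cast; ring, Complex.sub_im, Complex.one_im,
      Complex.exp_ofReal_mul_I_im, Real.sin_neg]; ring
  rw [Complex.sq_norm, Complex.normSq_apply, hre, him]
  nlinarith [Real.sin_sq_add_cos_sq x]

variable (L : ℕ) [NeZero L]

/-- ★ the gradient-weight constant `c_W(λ₂) = 2ε₁/(2ε₁ − λ₂)`. -/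
noncomputable def cW (lam2 : ℝ) : ℝ := 2 * eps1 L / (2 * eps1 L - lam2)

/-- `c_W > 0` for `λ₂ < 2ε₁` (`L ≥ 4`, so `ε₁ > 0`). [folklore] -/
theorem cW_pos (hL : 4 ≤ L) {lam2 : ℝ} (hlam : lam2 < 2 * eps1 L) : 0 < cW L lam2 := by
  have h1 := eps1_pos L hL
  unfold cW; exact div_pos (by linarith) (by linarith)

/-- along `e ∈ E4` the one-dimensional dispersion is a part of `ε(q)`: `1 − cos(θ·(rep q·e)) ≤ ε(q)`. [folklore] -/
theorem one_sub_cos_qdot_le_epsT (q : Tor L) {e : ℤ × ℤ} (he : e ∈ E4) :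
    1 - Real.cos ((2 * Real.pi / L) * ((qdot (B1.rep L q) e : ℤ) : ℝ)) ≤ epsT L q := by
  rw [epsT_eq_wInt]
  have h1 := wInt_nonneg L q.1.valMinAbs
  have h2 := wInt_nonneg L q.2.valMinAbs
  unfold B1.rep qdot
  simp only [E4, List.mem_cons, List.not_mem_nil, or_false] at he
  rcases he with rfl | rfl | rfl | rfl
  · have : 1 - Real.cos ((2 * Real.pi / L) * (((q.1.valMinAbs : ℤ) * 1 + (q.2.valMinAbs : ℤ) * 0 : ℤ) : ℝ)) = wInt L q.1.valMinAbs := by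
      unfold wInt; push_cast; ring_nf
    rw [this]; linarith
  · have : 1 - Real.cos ((2 * Real.pi / L) * (((q.1.valMinAbs : ℤ) * (-1) + (q.2.valMinAbs : ℤ) * 0 : ℤ) : ℝ)) = wInt L q.1.valMinAbs := by
      unfold wInt; push_cast
      rw [show 2 * Real.pi / (L : ℝ) * ((q.1.valMinAbs : ℝ) * -1 + (q.2.valMinAbs : ℝ) * 0) = -(2 * Real.pi * (q.1.valMinAbs : ℝ) / L) by ring,
        Real.cos_neg]
    rw [this]; linarith
  · have : 1 - Real.cos ((2 * Real.pi / L) * (((q.1.valMinAbs : ℤ) * 0 + (q.2.valMinAbs : ℤ) * 1 : ℤ) : ℝ)) = wInt L q.2.valMinAbs := by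
      unfold wInt; push_cast; ring_nf
    rw [this]; linarith
  · have : 1 - Real.cos ((2 * Real.pi / L) * (((q.1.valMinAbs : ℤ) * 0 + (q.2.valMinAbs : ℤ) * (-1) : ℤ) : ℝ)) = wInt L q.2.valMinAbs := by
      unfold wInt; push_cast
      rw [show 2 * Real.pi / (L : ℝ) * ((q.1.valMinAbs : ℝ) * 0 + (q.2.valMinAbs : ℝ) * -1) = -(2 * Real.pi * (q.2.valMinAbs : ℝ) / L) by ring,
        Real.cos_neg]
    rw [this]; linarith

/-- ★ `w_e(q)² ≤ 2ε(q)` (`e ∈ E4`): the gradient weight squared is twice the dispersion along `e`. [folklore] -/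
theorem wnorm_sq_le_two_epsT (q : Tor L) {e : ℤ × ℤ} (he : e ∈ E4) :
    wnorm L q (B1.toTor L e) ^ 2 ≤ 2 * epsT L q := by
  have h := one_sub_cos_qdot_le_epsT L q he
  unfold wnorm
  have hq : q = B1.toTor L (B1.rep L q) := (B1.toTor_rep L q).symm
  conv_lhs => rw [hq]
  rw [conj_phase_toTor_E4 L (B1.rep L q) e,
    show -(Complex.I * ((2 * Real.pi / L : ℝ) : ℂ) * ((qdot (B1.rep L q) e : ℤ) : ℂ))
      = -(Complex.I * (((2 * Real.pi / L) * ((qdot (B1.rep L q) e : ℤ) : ℝ) : ℝ) : ℂ)) by push_cast; ring,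
    norm_one_sub_exp_neg_sq]
  linarith

/-- ★ THE `c_W` LEMMA: `(w_e(q)·g(q))² ≤ c_W·g(q)` for `0 ≤ λ₂ < 2ε₁`, `L ≥ 2`, `e ∈ E4`
(`w²g ≤ 2εg = 2ε/(2ε − λ₂) ≤ 2ε₁/(2ε₁ − λ₂)` off the origin; `g(0) = 0`). [folklore] -/
theorem wg_sq_leW (hL : 2 ≤ L) {lam2 : ℝ} (hlam0 : 0 ≤ lam2) (hlam : lam2 < 2 * eps1 L) (q : Tor L) {e : ℤ × ℤ} (he : e ∈ E4) :
    (wnorm L q (B1.toTor L e) * gres L lam2 q) ^ 2 ≤ cW L lam2 * gres L lam2 q := by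
  have hw := wnorm_sq_le_two_epsT L q he
  have hw0 : 0 ≤ wnorm L q (B1.toTor L e) := wnorm_nonneg L _ _
  unfold gres
  split_ifs with hk
  · simp
  · have hε := eps1_le_epsT L hL hk
    have hd1 : 0 < 2 * eps1 L - lam2 := by linarith
    have hd : 0 < 2 * epsT L q - lam2 := by linarith
    -- `2ε(q)/(2ε(q) − λ) ≤ 2ε₁/(2ε₁ − λ)`
    have key : 2 * epsT L q * (1 / (2 * epsT L q - lam2)) ≤ cW L lam2 := by
      unfold cW
      rw [mul_one_div, div_le_div_iff₀ hd hd1]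
      nlinarith [mul_le_mul_of_nonneg_right hε hlam0]
    calc (wnorm L q (B1.toTor L e) * (1 / (2 * epsT L q - lam2))) ^ 2
        = wnorm L q (B1.toTor L e) ^ 2 * (1 / (2 * epsT L q - lam2)) * (1 / (2 * epsT L q - lam2)) := by ring
      _ ≤ (2 * epsT L q) * (1 / (2 * epsT L q - lam2)) * (1 / (2 * epsT L q - lam2)) := by
          gcongr
      _ ≤ cW L lam2 * (1 / (2 * epsT L q - lam2)) := mul_le_mul_of_nonneg_right key (by positivity)

/-! ## §2 The sum families with a generic zone constant -/

section fam
variable (lam2 : ℝ)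

/-- ★ family `{G, GW, GW}` with a generic constant: `Σ_p g(ℓ₀p)·(w g)(ℓ₁p)·(w g)(ℓ₂p) ≤ c·S₂`. [folklore] -/
theorem fam_gwwC {c : ℝ} (hc : 0 ≤ c) (hν : lam2 / (2 * Real.pi / L) ^ 2 < 4 / Real.pi ^ 2)
    (hwg : ∀ q : Tor L, ∀ e ∈ E4, (wnorm L q (B1.toTor L e) * gres L lam2 q) ^ 2 ≤ c * gres L lam2 q)
    (σ₀ : Bool) (c₀ : Tor L) (σ₁ : Bool) (c₁ : Tor L) (σ₂ : Bool) (c₂ : Tor L)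
    {e₁ e₂ : ℤ × ℤ} (he₁ : e₁ ∈ E4) (he₂ : e₂ ∈ E4) :
    ∑ p : Tor L, gres L lam2 (affine L σ₀ c₀ p) * (wnorm L (affine L σ₁ c₁ p) (B1.toTor L e₁) * gres L lam2 (affine L σ₁ c₁ p))
        * (wnorm L (affine L σ₂ c₂ p) (B1.toTor L e₂) * gres L lam2 (affine L σ₂ c₂ p))
      ≤ c * S2n L lam2 :=
  sum_three_two_le hc (S2n_nonneg L lam2)
    (fun _ => g_nonneg L hν _) (fun _ => g_nonneg L hν _) (fun _ => g_nonneg L hν _)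
    (fun _ => mul_nonneg (wnorm_nonneg L _ _) (g_nonneg L hν _))
    (fun _ => hwg _ _ he₁) (fun _ => hwg _ _ he₂)
    (sum_gres_sq_affine L lam2 σ₀ c₀).le (sum_gres_sq_affine L lam2 σ₁ c₁).le (sum_gres_sq_affine L lam2 σ₂ c₂).le

/-- ★ family `{GW, GW}` with a generic constant: `Σ (w g)(ℓ₁p)(w g)(ℓ₂p) ≤ c·S₁`. [folklore] -/
theorem fam_wwC {c : ℝ} (hc : 0 ≤ c) (hν : lam2 / (2 * Real.pi / L) ^ 2 < 4 / Real.pi ^ 2)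
    (hwg : ∀ q : Tor L, ∀ e ∈ E4, (wnorm L q (B1.toTor L e) * gres L lam2 q) ^ 2 ≤ c * gres L lam2 q)
    (σ₁ : Bool) (c₁ : Tor L) (σ₂ : Bool) (c₂ : Tor L) {e₁ e₂ : ℤ × ℤ} (he₁ : e₁ ∈ E4) (he₂ : e₂ ∈ E4) :
    ∑ p : Tor L, (wnorm L (affine L σ₁ c₁ p) (B1.toTor L e₁) * gres L lam2 (affine L σ₁ c₁ p))
        * (wnorm L (affine L σ₂ c₂ p) (B1.toTor L e₂) * gres L lam2 (affine L σ₂ c₂ p))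
      ≤ c * S1n L lam2 :=
  sum_two_wt_le hc (S1n_nonneg L hν)
    (fun _ => g_nonneg L hν _) (fun _ => g_nonneg L hν _)
    (fun _ => mul_nonneg (wnorm_nonneg L _ _) (g_nonneg L hν _))
    (fun _ => hwg _ _ he₁) (fun _ => hwg _ _ he₂)
    (sum_gres_affine L lam2 σ₁ c₁).le (sum_gres_affine L lam2 σ₂ c₂).le

/-- ★ family `{G, GW}` with a generic constant: `Σ g(ℓ₁p)·(w g)(ℓ₂p) ≤ √(c·S₂·S₁)`. [folklore] -/
theorem fam_gwC {c : ℝ} (hc : 0 ≤ c) (hν : lam2 / (2 * Real.pi / L) ^ 2 < 4 / Real.pi ^ 2)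
    (hwg : ∀ q : Tor L, ∀ e ∈ E4, (wnorm L q (B1.toTor L e) * gres L lam2 q) ^ 2 ≤ c * gres L lam2 q)
    (σ₁ : Bool) (c₁ : Tor L) (σ₂ : Bool) (c₂ : Tor L) {e₂ : ℤ × ℤ} (he₂ : e₂ ∈ E4) :
    ∑ p : Tor L, gres L lam2 (affine L σ₁ c₁ p) * (wnorm L (affine L σ₂ c₂ p) (B1.toTor L e₂) * gres L lam2 (affine L σ₂ c₂ p))
      ≤ Real.sqrt (c * S2n L lam2 * S1n L lam2) :=
  sum_one_wt_le hc (S2n_nonneg L lam2)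
    (fun _ => g_nonneg L hν _) (fun _ => g_nonneg L hν _)
    (fun _ => hwg _ _ he₂)
    (sum_gres_sq_affine L lam2 σ₁ c₁).le (sum_gres_sq_affine L lam2 σ₂ c₂).le (sum_gres_affine L lam2 σ₁ c₁).le

/-- ★ family `{GW}` with a generic constant: `Σ (w g)(ℓp) ≤ √(c·S₁·V)`. [folklore] -/
theorem fam_wC {c : ℝ} (hc : 0 ≤ c) (hν : lam2 / (2 * Real.pi / L) ^ 2 < 4 / Real.pi ^ 2)
    (hwg : ∀ q : Tor L, ∀ e ∈ E4, (wnorm L q (B1.toTor L e) * gres L lam2 q) ^ 2 ≤ c * gres L lam2 q)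
    (σ : Bool) (c₀ : Tor L) {e : ℤ × ℤ} (he : e ∈ E4) :
    ∑ p : Tor L, wnorm L (affine L σ c₀ p) (B1.toTor L e) * gres L lam2 (affine L σ c₀ p)
      ≤ Real.sqrt (c * S1n L lam2 * (L : ℝ) ^ 2) := by
  have hcard : (Fintype.card (Tor L) : ℝ) = (L : ℝ) ^ 2 := by
    rw [Fintype.card_prod, ZMod.card]; push_cast; ring
  rw [← hcard]
  exact sum_wt_le hc (S1n_nonneg L hν) (fun _ => g_nonneg L hν _) (fun _ => hwg _ _ he) (sum_gres_affine L lam2 σ c₀).le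

end fam

/-! ## §3 The N-type table with a generic zone constant -/

section three
variable (Δ lam2 : ℝ) (f : Tor L → ℝ)

/-- ★ the N-type table `bnd3` at the profile's data with a GENERIC zone constant `c` in place of `c_Z`. -/
noncomputable def bnd3AtC (c : ℝ) (ku kw kw' : Bool) : ℝ :=
  bnd3 (Δ * f (K1 L)) (cS L Δ lam2 f) (S1n L lam2) (S2n L lam2) ((L : ℝ) ^ 2) c ku kw kw'

/-- ★ THE N-TYPE PRODUCT BOUND with a generic zone constant `c`: `‖Σ_p R_u(affine L σu cu p) R_w(affine L σw cw p) R_w′(ℓw′ p)‖ ≤ bnd3 ku kw kw′` (legs sum-preserving, weight vectors in `E4`). [folklore] -/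
theorem norm_loop3w_leC {c : ℝ} (hc : 0 ≤ c)
    (hwg : ∀ q : Tor L, ∀ e ∈ E4, (wnorm L q (B1.toTor L e) * gres L lam2 q) ^ 2 ≤ c * gres L lam2 q) (hL : 128 ≤ L) (hΔ0 : 0 ≤ Δ) (hΔ1 : Δ < 1) (hf : IsGroundTwoMagnon L Δ lam2 f) (ku kw kw' : Bool) (eu : Tor L) {ew ew' : ℤ × ℤ}
    (hew : ew ∈ E4) (hew' : ew' ∈ E4) (σu : Bool) (cu : Tor L) (σw : Bool) (cw : Tor L) (σw' : Bool) (cw' : Tor L) :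
    ‖∑ p : Tor L, RfacU L lam2 (psiU L Δ lam2 f ku 1 0 eu) (affine L σu cu p)
        * RfacU L lam2 (psiU L Δ lam2 f kw 1 (-1) (B1.toTor L ew)) (affine L σw cw p)
        * RfacU L lam2 (psiU L Δ lam2 f kw' 1 (-1) (B1.toTor L ew')) (affine L σw' cw' p)‖
      ≤ bnd3AtC L Δ lam2 f c ku kw kw' := by
  obtain ⟨ha0', hcs0', -, hν, _⟩ := slot_regime L Δ lam2 f hL hΔ0 hΔ1 hf
  set a := Δ * f (K1 L) with ha
  set cs := cS L Δ lam2 f with hcs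
  set g := gres L lam2 with hg
  have ha0 : 0 ≤ a := ha0'
  have hcs0 : 0 ≤ cs := hcs0'
  have hg0 : ∀ q, 0 ≤ g q := fun q => g_nonneg L hν q
  have hw0 : ∀ q e, 0 ≤ wnorm L q e := fun q e => wnorm_nonneg L q e
  have hw2 : ∀ q e, wnorm L q e ≤ 2 := fun q e => wnorm_le_two L q e
  -- step 1: triangle inequality with the pointwise norms
  refine (norm_sum_le _ _).trans ?_
  simp only [norm_mul, norm_plain L Δ lam2 f hL hΔ0 hΔ1 hf, norm_grad L Δ lam2 f hL hΔ0 hΔ1 hf]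
  -- step 2: the eight cases
  unfold bnd3AtC bnd3
  cases ku <;> cases kw <;> cases kw' <;>
    simp only [Bool.false_eq_true, if_false, if_true, ← ha, ← hcs, ← hg]
  · -- J J J : a · (w a) · (w a) ≤ a (2a)² V
    calc ∑ p, a * (wnorm L (affine L σw cw p) (B1.toTor L ew) * a) * (wnorm L (affine L σw' cw' p) (B1.toTor L ew') * a)
        ≤ ∑ _p : Tor L, a * (2 * a) * (2 * a) := Finset.sum_le_sum fun p _ => by
          have h1 := hw2 (affine L σw cw p) (B1.toTor L ew); have h2 := hw2 (affine L σw' cw' p) (B1.toTor L ew')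
          have h1' := hw0 (affine L σw cw p) (B1.toTor L ew); have h2' := hw0 (affine L σw' cw' p) (B1.toTor L ew')
          have := mul_le_mul h1 h2 h2' (by norm_num)
          nlinarith [mul_nonneg ha0 (mul_nonneg ha0 ha0)]
      _ = a * (2 * a) ^ 2 * (L : ℝ) ^ 2 := by
          rw [Finset.sum_const, Finset.card_univ, Fintype.card_prod, ZMod.card, nsmul_eq_mul]; push_cast; ring
  · -- J J S : a · (w a) · (w cs g) ≤ a cs (2a) √(cz S1 V)
    have hf := fam_wC L lam2 hc hν hwg σw' cw' hew'
    calc ∑ p, a * (wnorm L (affine L σw cw p) (B1.toTor L ew) * a) * (wnorm L (affine L σw' cw' p) (B1.toTor L ew') * (cs * g (affine L σw' cw' p)))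
        ≤ ∑ p, a * (2 * a) * cs * (wnorm L (affine L σw' cw' p) (B1.toTor L ew') * g (affine L σw' cw' p)) := Finset.sum_le_sum fun p _ => by
          have h1 := hw2 (affine L σw cw p) (B1.toTor L ew)
          have hx : 0 ≤ wnorm L (affine L σw' cw' p) (B1.toTor L ew') * g (affine L σw' cw' p) := mul_nonneg (hw0 _ _) (hg0 _)
          have : a * (wnorm L (affine L σw cw p) (B1.toTor L ew) * a) ≤ a * (2 * a) := by
            nlinarith [mul_nonneg (mul_nonneg ha0 ha0) (sub_nonneg.2 h1)]
          calc a * (wnorm L (affine L σw cw p) (B1.toTor L ew) * a) * (wnorm L (affine L σw' cw' p) (B1.toTor L ew') * (cs * g (affine L σw' cw' p)))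
              = (a * (wnorm L (affine L σw cw p) (B1.toTor L ew) * a)) * cs * (wnorm L (affine L σw' cw' p) (B1.toTor L ew') * g (affine L σw' cw' p)) := by ring
            _ ≤ (a * (2 * a)) * cs * (wnorm L (affine L σw' cw' p) (B1.toTor L ew') * g (affine L σw' cw' p)) := by gcongr
      _ = a * (2 * a) * cs * ∑ p, wnorm L (affine L σw' cw' p) (B1.toTor L ew') * g (affine L σw' cw' p) := by rw [Finset.mul_sum]
      _ ≤ a * (2 * a) * cs * Real.sqrt (c * S1n L lam2 * (L : ℝ) ^ 2) := by gcongr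
      _ = a * cs * (2 * a) * Real.sqrt (c * S1n L lam2 * (L : ℝ) ^ 2) := by ring
  · -- J S J
    have hf := fam_wC L lam2 hc hν hwg σw cw hew
    calc ∑ p, a * (wnorm L (affine L σw cw p) (B1.toTor L ew) * (cs * g (affine L σw cw p))) * (wnorm L (affine L σw' cw' p) (B1.toTor L ew') * a)
        ≤ ∑ p, a * (2 * a) * cs * (wnorm L (affine L σw cw p) (B1.toTor L ew) * g (affine L σw cw p)) := Finset.sum_le_sum fun p _ => by
          have h2 := hw2 (affine L σw' cw' p) (B1.toTor L ew')
          have hx : 0 ≤ wnorm L (affine L σw cw p) (B1.toTor L ew) * g (affine L σw cw p) := mul_nonneg (hw0 _ _) (hg0 _)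
          have : a * (wnorm L (affine L σw' cw' p) (B1.toTor L ew') * a) ≤ a * (2 * a) := by
            nlinarith [mul_nonneg (mul_nonneg ha0 ha0) (sub_nonneg.2 h2)]
          calc a * (wnorm L (affine L σw cw p) (B1.toTor L ew) * (cs * g (affine L σw cw p))) * (wnorm L (affine L σw' cw' p) (B1.toTor L ew') * a)
              = (a * (wnorm L (affine L σw' cw' p) (B1.toTor L ew') * a)) * cs * (wnorm L (affine L σw cw p) (B1.toTor L ew) * g (affine L σw cw p)) := by ring
            _ ≤ (a * (2 * a)) * cs * (wnorm L (affine L σw cw p) (B1.toTor L ew) * g (affine L σw cw p)) := by gcongr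
      _ = a * (2 * a) * cs * ∑ p, wnorm L (affine L σw cw p) (B1.toTor L ew) * g (affine L σw cw p) := by rw [Finset.mul_sum]
      _ ≤ a * (2 * a) * cs * Real.sqrt (c * S1n L lam2 * (L : ℝ) ^ 2) := by gcongr
      _ = a * cs * (2 * a) * Real.sqrt (c * S1n L lam2 * (L : ℝ) ^ 2) := by ring
  · -- J S S : a (w cs g)(w cs g) ≤ a cs² cz S1
    have hf := fam_wwC L lam2 hc hν hwg σw cw σw' cw' hew hew'
    calc ∑ p, a * (wnorm L (affine L σw cw p) (B1.toTor L ew) * (cs * g (affine L σw cw p))) * (wnorm L (affine L σw' cw' p) (B1.toTor L ew') * (cs * g (affine L σw' cw' p)))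
        = a * cs ^ 2 * ∑ p, (wnorm L (affine L σw cw p) (B1.toTor L ew) * g (affine L σw cw p)) * (wnorm L (affine L σw' cw' p) (B1.toTor L ew') * g (affine L σw' cw' p)) := by
          rw [Finset.mul_sum]; exact Finset.sum_congr rfl fun p _ => by ring
      _ ≤ a * cs ^ 2 * (c * S1n L lam2) := by gcongr
  · -- S J J : cs g · (w a)(w a) ≤ cs (2a)² S1
    have hf := fam_g L σu cu lam2
    calc ∑ p, cs * g (affine L σu cu p) * (wnorm L (affine L σw cw p) (B1.toTor L ew) * a) * (wnorm L (affine L σw' cw' p) (B1.toTor L ew') * a)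
        ≤ ∑ p, cs * (2 * a) ^ 2 * g (affine L σu cu p) := Finset.sum_le_sum fun p _ => by
          have h1 := hw2 (affine L σw cw p) (B1.toTor L ew); have h2 := hw2 (affine L σw' cw' p) (B1.toTor L ew')
          have h1' := hw0 (affine L σw cw p) (B1.toTor L ew); have h2' := hw0 (affine L σw' cw' p) (B1.toTor L ew')
          have hww : wnorm L (affine L σw cw p) (B1.toTor L ew) * wnorm L (affine L σw' cw' p) (B1.toTor L ew') ≤ 2 * 2 := mul_le_mul h1 h2 h2' (by norm_num)
          have hx : 0 ≤ cs * g (affine L σu cu p) * (a * a) := by have := hg0 (affine L σu cu p); positivity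
          calc cs * g (affine L σu cu p) * (wnorm L (affine L σw cw p) (B1.toTor L ew) * a) * (wnorm L (affine L σw' cw' p) (B1.toTor L ew') * a)
              = cs * g (affine L σu cu p) * (a * a) * (wnorm L (affine L σw cw p) (B1.toTor L ew) * wnorm L (affine L σw' cw' p) (B1.toTor L ew')) := by ring
            _ ≤ cs * g (affine L σu cu p) * (a * a) * (2 * 2) := mul_le_mul_of_nonneg_left hww hx
            _ = cs * (2 * a) ^ 2 * g (affine L σu cu p) := by ring
      _ = cs * (2 * a) ^ 2 * S1n L lam2 := by rw [← Finset.mul_sum, hf]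
  · -- S J S : cs g · (w a) · (w cs g) ≤ cs² (2a) √(cz S2 S1)
    have hf := fam_gwC L lam2 hc hν hwg σu cu σw' cw' hew'
    calc ∑ p, cs * g (affine L σu cu p) * (wnorm L (affine L σw cw p) (B1.toTor L ew) * a) * (wnorm L (affine L σw' cw' p) (B1.toTor L ew') * (cs * g (affine L σw' cw' p)))
        ≤ ∑ p, cs ^ 2 * (2 * a) * (g (affine L σu cu p) * (wnorm L (affine L σw' cw' p) (B1.toTor L ew') * g (affine L σw' cw' p))) := Finset.sum_le_sum fun p _ => by
          have h1 := hw2 (affine L σw cw p) (B1.toTor L ew); have h1' := hw0 (affine L σw cw p) (B1.toTor L ew)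
          have hx : 0 ≤ cs ^ 2 * a * (g (affine L σu cu p) * (wnorm L (affine L σw' cw' p) (B1.toTor L ew') * g (affine L σw' cw' p))) := by
            have := hg0 (affine L σu cu p); have := hg0 (affine L σw' cw' p); have := hw0 (affine L σw' cw' p) (B1.toTor L ew'); positivity
          calc cs * g (affine L σu cu p) * (wnorm L (affine L σw cw p) (B1.toTor L ew) * a) * (wnorm L (affine L σw' cw' p) (B1.toTor L ew') * (cs * g (affine L σw' cw' p)))
              = cs ^ 2 * a * (g (affine L σu cu p) * (wnorm L (affine L σw' cw' p) (B1.toTor L ew') * g (affine L σw' cw' p))) * wnorm L (affine L σw cw p) (B1.toTor L ew) := by ring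
            _ ≤ cs ^ 2 * a * (g (affine L σu cu p) * (wnorm L (affine L σw' cw' p) (B1.toTor L ew') * g (affine L σw' cw' p))) * 2 := mul_le_mul_of_nonneg_left h1 hx
            _ = cs ^ 2 * (2 * a) * (g (affine L σu cu p) * (wnorm L (affine L σw' cw' p) (B1.toTor L ew') * g (affine L σw' cw' p))) := by ring
      _ = cs ^ 2 * (2 * a) * ∑ p, g (affine L σu cu p) * (wnorm L (affine L σw' cw' p) (B1.toTor L ew') * g (affine L σw' cw' p)) := by rw [Finset.mul_sum]
      _ ≤ cs ^ 2 * (2 * a) * Real.sqrt (c * S2n L lam2 * S1n L lam2) := by gcongr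
  · -- S S J
    have hf := fam_gwC L lam2 hc hν hwg σu cu σw cw hew
    calc ∑ p, cs * g (affine L σu cu p) * (wnorm L (affine L σw cw p) (B1.toTor L ew) * (cs * g (affine L σw cw p))) * (wnorm L (affine L σw' cw' p) (B1.toTor L ew') * a)
        ≤ ∑ p, cs ^ 2 * (2 * a) * (g (affine L σu cu p) * (wnorm L (affine L σw cw p) (B1.toTor L ew) * g (affine L σw cw p))) := Finset.sum_le_sum fun p _ => by
          have h2 := hw2 (affine L σw' cw' p) (B1.toTor L ew'); have h2' := hw0 (affine L σw' cw' p) (B1.toTor L ew')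
          have hx : 0 ≤ cs ^ 2 * a * (g (affine L σu cu p) * (wnorm L (affine L σw cw p) (B1.toTor L ew) * g (affine L σw cw p))) := by
            have := hg0 (affine L σu cu p); have := hg0 (affine L σw cw p); have := hw0 (affine L σw cw p) (B1.toTor L ew); positivity
          calc cs * g (affine L σu cu p) * (wnorm L (affine L σw cw p) (B1.toTor L ew) * (cs * g (affine L σw cw p))) * (wnorm L (affine L σw' cw' p) (B1.toTor L ew') * a)
              = cs ^ 2 * a * (g (affine L σu cu p) * (wnorm L (affine L σw cw p) (B1.toTor L ew) * g (affine L σw cw p))) * wnorm L (affine L σw' cw' p) (B1.toTor L ew') := by ring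
            _ ≤ cs ^ 2 * a * (g (affine L σu cu p) * (wnorm L (affine L σw cw p) (B1.toTor L ew) * g (affine L σw cw p))) * 2 := mul_le_mul_of_nonneg_left h2 hx
            _ = cs ^ 2 * (2 * a) * (g (affine L σu cu p) * (wnorm L (affine L σw cw p) (B1.toTor L ew) * g (affine L σw cw p))) := by ring
      _ = cs ^ 2 * (2 * a) * ∑ p, g (affine L σu cu p) * (wnorm L (affine L σw cw p) (B1.toTor L ew) * g (affine L σw cw p)) := by rw [Finset.mul_sum]
      _ ≤ cs ^ 2 * (2 * a) * Real.sqrt (c * S2n L lam2 * S1n L lam2) := by gcongr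
  · -- S S S : cs g (w cs g)(w cs g) ≤ cs³ cz S2
    have hf := fam_gwwC L lam2 hc hν hwg σu cu σw cw σw' cw' hew hew'
    calc ∑ p, cs * g (affine L σu cu p) * (wnorm L (affine L σw cw p) (B1.toTor L ew) * (cs * g (affine L σw cw p))) * (wnorm L (affine L σw' cw' p) (B1.toTor L ew') * (cs * g (affine L σw' cw' p)))
        = cs ^ 3 * ∑ p, g (affine L σu cu p) * (wnorm L (affine L σw cw p) (B1.toTor L ew) * g (affine L σw cw p)) * (wnorm L (affine L σw' cw' p) (B1.toTor L ew') * g (affine L σw' cw' p)) := by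
          rw [Finset.mul_sum]; exact Finset.sum_congr rfl fun p _ => by ring
      _ ≤ cs ^ 3 * (c * S2n L lam2) := by gcongr


/-- ★ the slot hypothesis holds with `c = c_W(λ₂)` at a ground profile with `L ≥ 128`, `0 ≤ Δ < 1`. [folklore] -/
theorem wg_hypW (hL : 128 ≤ L) (hΔ0 : 0 ≤ Δ) (hΔ1 : Δ < 1) (hf : IsGroundTwoMagnon L Δ lam2 f) :
    0 ≤ cW L lam2 ∧ ∀ q : Tor L, ∀ e ∈ E4, (wnorm L q (B1.toTor L e) * gres L lam2 q) ^ 2 ≤ cW L lam2 * gres L lam2 q := by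
  have hlam : lam2 < 2 * eps1 L := (slot_regime L Δ lam2 f hL hΔ0 hΔ1 hf).2.2.2.2
  have hlam0 : 0 ≤ lam2 := (lam2_pos L (by omega) hΔ1 hf.1).le
  exact ⟨(cW_pos L (by omega) hlam).le, fun q e he => wg_sq_leW L (by omega) hlam0 hlam q he⟩

/-- ★ the N-type product bound with `c_W`: `‖Σ_p R_u R_w R_w′‖ ≤ bnd3AtC c_W ku kw kw′`. [folklore] -/
theorem norm_loop3w_leW (hL : 128 ≤ L) (hΔ0 : 0 ≤ Δ) (hΔ1 : Δ < 1) (hf : IsGroundTwoMagnon L Δ lam2 f) (ku kw kw' : Bool) (eu : Tor L)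
    {ew ew' : ℤ × ℤ} (hew : ew ∈ E4) (hew' : ew' ∈ E4) (σu : Bool) (cu : Tor L) (σw : Bool) (cw : Tor L) (σw' : Bool) (cw' : Tor L) :
    ‖∑ p : Tor L, RfacU L lam2 (psiU L Δ lam2 f ku 1 0 eu) (affine L σu cu p)
        * RfacU L lam2 (psiU L Δ lam2 f kw 1 (-1) (B1.toTor L ew)) (affine L σw cw p)
        * RfacU L lam2 (psiU L Δ lam2 f kw' 1 (-1) (B1.toTor L ew')) (affine L σw' cw' p)‖
      ≤ bnd3AtC L Δ lam2 f (cW L lam2) ku kw kw' := by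
  obtain ⟨hc, hwg⟩ := wg_hypW L Δ lam2 f hL hΔ0 hΔ1 hf
  exact norm_loop3w_leC L Δ lam2 f hc hwg hL hΔ0 hΔ1 hf ku kw kw' eu hew hew' σu cu σw cw σw' cw'

end three

end RowD

end Summit.HubbardSuperconductivity.HubbardSuperconductivity.Theorems.AnisotropyChord.Transfer.Fibre3
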